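import Literature.AlgebraicGeometry.FundamentalGroup.RiemannExistenceSmoothAffine
import Literature.AlgebraicGeometry.FundamentalGroup.RiemannExistenceSeparatingIff
import HarnessLib

/-!
# Riemann's existence theorem for smooth complex varieties (SGA 1 XII Thm. 5.1, smooth case), proved

Topic `Literature/AlgebraicGeometry/FundamentalGroup`; theorems only (no definition, no named fact).

SGA 1, Exp. XII Thm. 5.1 («théorème d'existence de Riemann»): for `X` locally of finite type over
`ℂ` the functor `X' ↦ X'^an` is an equivalence from finite étale covers of `X` onto finite étale
(= finite-fibred topological) covers of `X^an`. Its essential surjectivity for SMOOTH IRREDUCIBLE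
quasi-projective `X` is proved here WITHOUT hypotheses:

* `riemannExistence_smoothAffine` — every covering map `q : T → S(ℂ)` with finite fibres, `S` a
  smooth irreducible AFFINE `ℂ`-scheme, is `S'(ℂ) → S(ℂ)` for a finite étale `S' ⟶ S`
  (`T ≃ₜ S'(ℂ)` over `S(ℂ)`). Proof = the printed proof, part 2, with the transcendental input
  supplied by the tree: locally algebraic separating functions
  (`SmoothAffine.exists_locallyAlgebraicSeparating`, Hörmander's weighted `L²` estimates on the flat
  Riemann domain `q⁻¹(U(ℂ))` in étale coordinates, `RiemannExistenceSmoothAffine.lean`), their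
  monic regular characteristic polynomials (Theorem B′,
  `ContinuousRational.exists_charPoly_of_algebraic`, the local rings of `S` being regular) and the
  algebraisation-and-gluing Theorem A
  (`CharPoly.exists_finite_etale_homeomorph_of_charPoly_of_isCoveringMap`).
* `riemannExistence_smooth` — the same for smooth irreducible QUASI-PROJECTIVE `S` («la question est
  locale sur `X`»: `ZariskiLocal.riemannExistence_of_affineOpens`).
* `riemannExistence_smooth_forall` — the curried `∀`-form, verbatim the hypothesis `hRiemann` /
  `hRE` of `riemannExistence_qbarDescent_of_finiteIndex_of_riemannExistence_smooth`,
  `integralSeparating_of_riemannExistence_smooth` and of the `HodgeTheory` `ℚ̄`-descent files, and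
  the left-hand side of `riemannExistence_smooth_iff_algebraicSeparating`.
* `integralSeparating_smoothAffine` / `algebraicSeparating_smoothAffine` — consequently, on every
  finite-fibred covering of a smooth irreducible affine `S(ℂ)` there are GLOBAL continuous functions,
  integral over `Γ(S, 𝒪_S)`, separating any prescribed fibre (the right-hand sides of
  `riemannExistence_smooth_iff_algebraicSeparating` /
  `riemannExistence_qbarDescent_of_finiteIndex_of_integralSeparating`).

What is NOT here: the general case of the named fact `riemannExistence_finiteCovering` (arbitrary
quasi-projective `S`), which by `riemannExistence_finiteCovering_iff_algebraicSeparating` still needs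
separating functions over NORMAL affine bases (normalisation + Riemann extension across the singular
locus in the printed proof).

## References

* [SGA1] A. Grothendieck, M. Raynaud, *Revêtements étales et groupe fondamental (SGA 1)*, LNM 224 /
  arXiv:math/0206203, Exp. XII Thm. 5.1 (p. 333) and its proof, part 2.
* [HormanderSCV1973] L. Hörmander, *An Introduction to Complex Analysis in Several Variables*,
  Thm. 4.4.3–4.4.4, §5.4 (the analytic input, through `RiemannExistenceSmoothAffine.lean`).

#harness_tags algebraic_geometry.sga1, complex_geometry.riemann_existence, algebraic_geometry.hodge_conjecture
-/

noncomputable section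

open CategoryTheory AlgebraicGeometry Polynomial
open _root_.Topology

namespace Literature.AlgebraicGeometry.FundamentalGroup

open Literature.AlgebraicGeometry.Motives Literature.AlgebraicGeometry.Motives.AlgPoints
open Literature.AlgebraicGeometry.HodgeTheory Literature.AlgebraicGeometry.Resolution

/-- **Riemann's existence theorem for smooth irreducible affine complex varieties (SGA 1 XII
Thm. 5.1, essential surjectivity).** Every covering map `q : T → S(ℂ)` with finite fibres, `S` a
smooth irreducible affine `ℂ`-scheme, is the map on complex points of a finite étale `S' ⟶ S`:
there are `S'`, `g : S' ⟶ S` finite étale and a homeomorphism `Φ : S'(ℂ) ≃ₜ T` with `q ∘ Φ = g(ℂ)`.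
Printed proof, part 2: about each `P₀ ∈ S(ℂ)` the sheets of `q` are separated by a function
continuous over an affine open `U ∋ P₀` and algebraic over `Γ(S, U)`
(`SmoothAffine.exists_locallyAlgebraicSeparating` — the transcendental input, Hörmander's `L²`
estimates in étale coordinates); its characteristic polynomial along `q` is a monic polynomial over
`Γ(S, U)` with the right roots fibre by fibre (Theorem B′,
`ContinuousRational.exists_charPoly_of_algebraic`: `S` has regular local rings); the standard étale
algebras these polynomials define glue to `S'` (Theorem A,
`CharPoly.exists_finite_etale_homeomorph_of_charPoly_of_isCoveringMap`).
[cite: SGA1, Exp. XII Thm. 5.1 (p. 333), proof, part 2]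
[cite: HormanderSCV1973, Thm 4.4.3-4.4.4, §5.4] -/
theorem riemannExistence_smoothAffine (S : SchemeOver ℂ) [IsAffine S.left]
    [AlgebraicGeometry.Smooth S.hom] [IrreducibleSpace S.left] (T : Type) [TopologicalSpace T]
    (q : T → ComplexPoints S) (hq : IsCoveringMap q) (hfin : ∀ t, (q ⁻¹' {t}).Finite) :
    ∃ (S' : SchemeOver ℂ) (g : S' ⟶ S) (Φ : ComplexPoints S' ≃ₜ T),
      IsFinite g.left ∧ Etale g.left ∧ ∀ z, q (Φ z) = AlgPoints.map g z := by
  haveI : IsSeparated S.hom := inferInstance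
  haveI : LocallyOfFiniteType S.hom := inferInstance
  -- `S` is integral with regular local rings: smooth over `ℂ` and irreducible
  have hSreg : Scheme.IsRegular S.left :=
    Scheme.IsRegular.of_smooth S.hom (Scheme.isRegular_Spec (CommRingCat.of ℂ))
  haveI : IsReduced S.left := hSreg.isReduced
  haveI : IsIntegral S.left := isIntegral_of_irreducibleSpace_of_isReduced _
  refine CharPoly.exists_finite_etale_homeomorph_of_charPoly_of_isCoveringMap q hq hfin fun P₀ ↦ ?_
  -- transcendental input: a locally algebraic separating function about `P₀`
  obtain ⟨U, hU, hP₀U, h, F, hh, hF, hroot, hinj⟩ :=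
    SmoothAffine.exists_locallyAlgebraicSeparating S T q hq hfin P₀
  -- Theorem B′: its characteristic polynomial over `U` is monic regular with the right roots
  obtain ⟨Q, hQ, hroots⟩ := ContinuousRational.exists_charPoly_of_algebraic (X := S) hSreg
    hU hq hfin h hh F hF hroot
  exact ⟨U, hU, hP₀U, h, Q, hh, hQ, hroots, hinj⟩

/-- **Riemann's existence theorem for smooth irreducible quasi-projective complex varieties (SGA 1
XII Thm. 5.1, essential surjectivity).** Every covering map `q : T → S(ℂ)` with finite fibres, `S`
smooth irreducible and quasi-projective over `ℂ`, is `S'(ℂ) → S(ℂ)` for a finite étale `S' ⟶ S`.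
«Compte tenu de 1) la question est locale sur `X`, et on peut donc supposer `X` affine»: essential
surjectivity glues along the affine opens (`ZariskiLocal.riemannExistence_of_affineOpens`, using the
full faithfulness of `X' ↦ X'(ℂ)`), and a non-empty affine open of `S` is a smooth irreducible affine
`ℂ`-scheme, where `riemannExistence_smoothAffine` applies.
[cite: SGA1, Exp. XII Thm. 5.1 (p. 333), proof, part 2] -/
theorem riemannExistence_smooth (S : SchemeOver ℂ) (hS : IsQuasiProjectiveOver S)
    [AlgebraicGeometry.Smooth S.hom] [IrreducibleSpace S.left] (T : Type) [TopologicalSpace T]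
    (q : T → ComplexPoints S) (hq : IsCoveringMap q) (hfin : ∀ t, (q ⁻¹' {t}).Finite) :
    ∃ (S' : SchemeOver ℂ) (g : S' ⟶ S) (Φ : ComplexPoints S' ≃ₜ T),
      IsFinite g.left ∧ Etale g.left ∧ ∀ z, q (Φ z) = AlgPoints.map g z := by
  haveI : LocallyOfFiniteType S.hom := hS.locallyOfFiniteType
  haveI : IsSeparated S.hom := hS.isVarietyPair_ofScheme.isSeparated
  -- `S` is integral: smooth over `ℂ` (regular, hence reduced) and irreducible
  have hSreg : Scheme.IsRegular S.left :=
    Scheme.IsRegular.of_smooth S.hom (Scheme.isRegular_Spec (CommRingCat.of ℂ))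
  haveI : IsReduced S.left := hSreg.isReduced
  haveI : IsIntegral S.left := isIntegral_of_irreducibleSpace_of_isReduced _
  refine ZariskiLocal.riemannExistence_of_affineOpens (X := S) (fun U hU hne T' _ q' hq' hfin' ↦ ?_)
    q hq hfin
  -- the non-empty affine open `U ⊆ S` is affine, smooth over `ℂ` and irreducible
  haveI : Nonempty (U : Scheme) := hne.to_subtype
  haveI : IsIntegral (U : Scheme) := isIntegral_of_isOpenImmersion U.ι
  haveI : IsAffine (openSubschemeOver S U).left := hU
  haveI : AlgebraicGeometry.Smooth (openSubschemeOver S U).hom :=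
    inferInstanceAs (AlgebraicGeometry.Smooth (U.ι ≫ S.hom))
  haveI : IrreducibleSpace (openSubschemeOver S U).left :=
    inferInstanceAs (IrreducibleSpace (U : Scheme))
  exact riemannExistence_smoothAffine _ T' q' hq' hfin'

/-- The curried `∀`-form of `riemannExistence_smooth` — verbatim the hypothesis `hRiemann` / `hRE`
of `riemannExistence_qbarDescent_of_finiteIndex_of_riemannExistence_smooth`,
`integralSeparating_of_riemannExistence_smooth`,
`HodgeTheory.finiteCovering_descends_to_qbar_of_riemannExistence_of_smooth` and the left-hand side
of `riemannExistence_smooth_iff_algebraicSeparating`, now a theorem.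
[cite: SGA1, Exp. XII Thm. 5.1 (p. 333)] -/
theorem riemannExistence_smooth_forall :
    ∀ (S : SchemeOver ℂ), IsQuasiProjectiveOver S → AlgebraicGeometry.Smooth S.hom →
      IrreducibleSpace S.left →
      ∀ (T : Type) [TopologicalSpace T] (q : T → ComplexPoints S),
        IsCoveringMap q → (∀ t, (q ⁻¹' {t}).Finite) →
        ∃ (S' : SchemeOver ℂ) (g : S' ⟶ S) (Φ : ComplexPoints S' ≃ₜ T),
          IsFinite g.left ∧ Etale g.left ∧ ∀ z, q (Φ z) = AlgPoints.map g z :=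
  fun S hS hsm hirr T _ q hq hfin ↦ by
    haveI := hsm
    haveI := hirr
    exact riemannExistence_smooth S hS T q hq hfin

/-- **Global integral separating functions on finite coverings of smooth affine varieties.** For
`S` a smooth irreducible affine `ℂ`-scheme, `q : T → S(ℂ)` a covering map with finite fibres and
`P₀ ∈ S(ℂ)`, there is a continuous `h : T → ℂ`, INTEGRAL over `Γ(S, 𝒪_S)` along `q` (`R(q t)(h t) = 0`
for one monic `R ∈ Γ(S, 𝒪_S)[τ]`) and injective on `q⁻¹(P₀)`: by `riemannExistence_smooth`,
`T = S'(ℂ)` with `S' = Spec B` finite over `S`, and a `b ∈ B` with prescribed distinct values on the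
fibre (Chinese remainder theorem; `integralSeparating_of_riemannExistence_smooth`) does it. This is
the right-hand side of `riemannExistence_qbarDescent_of_finiteIndex_of_integralSeparating`, now a
theorem. [cite: SGA1, Exp. XII Thm. 5.1 (p. 333), proof, part 2] -/
theorem integralSeparating_smoothAffine (S : SchemeOver ℂ) [IsAffine S.left]
    [AlgebraicGeometry.Smooth S.hom] [IrreducibleSpace S.left] {T : Type} [TopologicalSpace T]
    (q : T → ComplexPoints S) (hq : IsCoveringMap q) (hfin : ∀ t, (q ⁻¹' {t}).Finite)
    (P₀ : ComplexPoints S) :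
    ∃ (h : T → ℂ) (R : Polynomial Γ(S.left, ⊤)), Continuous h ∧ R.Monic ∧
      (∀ t, (R.map ((q t).evalRingHom ⊤ trivial)).eval (h t) = 0) ∧ Set.InjOn h (q ⁻¹' {P₀}) :=
  integralSeparating_of_riemannExistence_smooth riemannExistence_smooth_forall S q hq hfin P₀

/-- **Global algebraic separating functions on finite coverings of smooth affine varieties** — the
right-hand side of `riemannExistence_smooth_iff_algebraicSeparating` and the hypothesis of
`riemannExistence_qbarDescent_of_finiteIndex_of_algebraicSeparating`, now a theorem (a monic
relation is a non-zero one, `Γ(S, 𝒪_S)` being non-trivial as `S(ℂ) ∋ P₀`).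
[cite: SGA1, Exp. XII Thm. 5.1 (p. 333), proof, part 2] -/
theorem algebraicSeparating_smoothAffine :
    ∀ (S : SchemeOver ℂ), IsAffine S.left → AlgebraicGeometry.Smooth S.hom →
      IrreducibleSpace S.left →
      ∀ (T : Type) [TopologicalSpace T] (q : T → ComplexPoints S) (_ : IsCoveringMap q)
        (_ : ∀ t, (q ⁻¹' {t}).Finite) (P₀ : ComplexPoints S),
        ∃ (h : T → ℂ) (F : Polynomial Γ(S.left, ⊤)), Continuous h ∧ F ≠ 0 ∧
          (∀ t, (F.map ((q t).evalRingHom ⊤ trivial)).eval (h t) = 0) ∧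
          Set.InjOn h (q ⁻¹' {P₀}) :=
  riemannExistence_smooth_iff_algebraicSeparating.1 riemannExistence_smooth_forall

end Literature.AlgebraicGeometry.FundamentalGroup

end
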